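import Summits.CriticalPhenomena.PercolationContinuityZ3.Theorems.Transplant.SharpnessGridCoarse
import Summits.CriticalPhenomena.PercolationContinuityZ3.Theorems.Transplant.SharpnessGridCells
import HarnessLib

/-!
# Transplant sharpness VIII — passable walls between clear cells are blocked dual passages

builds on p205010 (kernel theorem, internal audit signed; external expert review pending).
Status sentence (coordinator 2026-08-20T04:30Z): "θ(p_c) = 0 on ℤ^d, all d ≥ 2 — kernel-verified (Lean 4/Mathlib,
standard axioms); internal adversarial audit SIGNED 2026-08-20 04:29Z; external expert review pending."

Lane `prim-bschramm`, seat p5 (sharpness); memo `run/shared/lean/prim/bschramm/prim-bschramm-p5-g19/GRIDWEDGE-PROOF.md`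
§4.2 and §7 (M1).  Part of module (M1) of the kernel route for the hard half of P5-SHARPNESS row 83 (the gridded
log-wedge `ℤ²[W ∪ L_M]` has the wedge's critical point).  Everything here is deterministic planar bookkeeping for the
square lattice and PROVED.

* `openConnIn_dual_run` — a straight run of dual steps is `dualConfig ω`-open when no crossed edge is in `ω`;
* `openConnIn_dualConfig_passable_right` / `_up` — REALISATION: if two adjacent cells are clear for `ω` and their
  common wall is passable (some wall edge not in `ω`), then the lower-left plaquettes of the two cells are joined by a
  `dualConfig ω`-open dual path all of whose plaquettes lie in the two cells (route: along, through the missing wall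
  edge, back; GRIDWEDGE-PROOF §4.2);
* `openConnIn_dualConfig_of_coarse_adj`, `openConnIn_dualConfig_of_coarse` — hence a `dualConfig (coarseConfig M ω)`-open
  walk through clear cells (a hole-chain through passable walls) yields a `dualConfig ω`-open dual path through
  plaquettes of those cells.

References: G. Grimmett, *Percolation*, 2nd ed. (1999), §1.4 pp. 16–17, §11.2; H. Kesten, *Percolation Theory for
Mathematicians* (1982), §2.2.
-/

namespace Summit.CriticalPhenomena.PercolationContinuityZ3.Theorems.TransplantSharpness

open Literature.Probability.Percolation Literature.Probability.LatticeModels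

/-! ## Straight dual runs -/

/-- **A straight run of `n` dual steps in direction `dir`** from plaquette `a` is `dualConfig ω`-open inside `S` as soon
as its plaquettes lie in `S` and none of the `n` crossed edges is in `ω`. [folklore] -/
theorem openConnIn_dual_run {ω : BondConfig (Site 2)} (hω : ω ⊆ (zdGraph 2).edgeSet) {S : Set (Site 2)}
    (a : Site 2) (dir : Fin 2 × Bool) :
    ∀ (n : ℕ), (∀ r : ℕ, r ≤ n → a + (r : ℤ) • stepVec dir ∈ S) →
      (∀ r : ℕ, r < n → crossedEdge (a + (r : ℤ) • stepVec dir) dir ∉ ω) →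
      dualConfig ω ∈ openConnIn S a (a + (n : ℤ) • stepVec dir)
  | 0, hS, _ => by simpa using (openConnIn_refl (hS 0 le_rfl) : dualConfig ω ∈ openConnIn S _ _)
  | n + 1, hS, hcross => by
    have ih := openConnIn_dual_run hω a dir n (fun r hr => hS r (hr.trans (Nat.le_succ n)))
      (fun r hr => hcross r (hr.trans (Nat.lt_succ_self n)))
    have hb : a + ((n : ℕ) : ℤ) • stepVec dir ∈ S := hS n (Nat.le_succ n)
    have hb' : a + (((n + 1 : ℕ)) : ℤ) • stepVec dir ∈ S := hS (n + 1) le_rfl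
    have heq : a + (((n + 1 : ℕ)) : ℤ) • stepVec dir = (a + (n : ℤ) • stepVec dir) + stepVec dir := by
      push_cast; rw [add_smul, one_smul, add_assoc]
    have hstep : s(a + (n : ℤ) • stepVec dir, (a + (n : ℤ) • stepVec dir) + stepVec dir) ∈ dualConfig ω :=
      (mem_dualConfig_step_iff hω _ dir).2 (hcross n (Nat.lt_succ_self n))
    have hadj := openConnIn_of_adj (ω := dualConfig ω) hb (heq ▸ hb') hstep (ne_add_stepVec _ dir)
    rw [← heq] at hadj
    exact PlanarDuality.openConnIn_trans ih hadj


/-! ## Realisation of a passable wall between two clear cells by a blocked dual passage -/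

/-- **Passage to the RIGHT.** If the cells `c` and `c + e₀` are clear for `ω ⊆ E(ℤ²)` (`M ≥ 2`) and the `t`-th edge of
their common wall is not in `ω`, then the plaquettes `M c` and `M (c + e₀)` are joined by a `dualConfig ω`-open dual
path all of whose plaquettes belong to the two cells (route: up `t`, right `M` through the missing wall edge, down
`t`; GRIDWEDGE-PROOF §4.2). [folklore] -/
theorem openConnIn_dualConfig_passable_right {ω : BondConfig (Site 2)} (hω : ω ⊆ (zdGraph 2).edgeSet) {M : ℕ}
    (hM : 2 ≤ M) {c : Site 2}
    (hc : ∀ e ∈ ω, ∀ v ∈ e, v ∉ cellInterior M c)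
    (hc' : ∀ e ∈ ω, ∀ v ∈ e, v ∉ cellInterior M (c + Pi.single 0 1))
    {t : ℕ} (ht : t < M) (hpass : wallEdge M (c + Pi.single 0 1) 1 t ∉ ω)
    {S : Set (Site 2)} (hS : cellFaces M c ⊆ S) (hS' : cellFaces M (c + Pi.single 0 1) ⊆ S) :
    dualConfig ω ∈ openConnIn S ((M : ℤ) • c) ((M : ℤ) • (c + Pi.single 0 1)) := by
  -- Run 1: up `t` steps from `M c = M c + (0,0)`
  have run1 : dualConfig ω ∈ openConnIn S ((M : ℤ) • c + ![0, 0]) ((M : ℤ) • c + ![0, 0] + (t : ℤ) • stepVec (1, true)) := by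
    refine openConnIn_dual_run hω _ (1, true) t (fun r hr => ?_) (fun r hr => ?_)
    · rw [base_add_smul_up]
      exact hS (base_add_mem_cellFaces_iff.2 ⟨le_rfl, by omega, by omega, by omega⟩)
    · rw [base_add_smul_up, crossedEdge_base_up]
      exact not_mem_of_clear hc (Or.inr (base_add_mem_cellInterior_iff.2 ⟨by omega, by omega, by omega, by omega⟩))
  rw [base_add_smul_up] at run1
  -- Run 2: right `M` steps from `M c + (0, t)`
  have run2 : dualConfig ω ∈ openConnIn S ((M : ℤ) • c + ![0, 0 + (t : ℤ)])
      ((M : ℤ) • c + ![0, 0 + (t : ℤ)] + (M : ℤ) • stepVec (0, true)) := by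
    refine openConnIn_dual_run hω (S := S) ((M : ℤ) • c + ![0, 0 + (t : ℤ)]) (0, true) M (fun r hr => ?_)
      (fun r hr => ?_)
    · rw [base_add_smul_right]
      rcases Nat.lt_or_ge r M with h | h
      · exact hS (base_add_mem_cellFaces_iff.2 ⟨by omega, by omega, by omega, by omega⟩)
      · exact hS' (base_add_mem_cellFaces_right_iff.2 ⟨by omega, by omega, by omega, by omega⟩)
    · rw [base_add_smul_right, crossedEdge_base_right]
      rcases Nat.lt_or_ge (r + 1) M with h | h
      · rcases Nat.eq_zero_or_pos t with h0 | h0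
        · exact not_mem_of_clear hc (Or.inr (base_add_mem_cellInterior_iff.2 ⟨by omega, by omega, by omega, by omega⟩))
        · exact not_mem_of_clear hc (Or.inl (base_add_mem_cellInterior_iff.2 ⟨by omega, by omega, by omega, by omega⟩))
      · have hrM : r + 1 = M := by omega
        have e1 : (![0 + (r : ℤ) + 1, 0 + (t : ℤ)] : Site 2) = ![(M : ℤ), (t : ℤ)] := by ext k; fin_cases k <;> [(simp; omega); simp]
        have e2 : (![0 + (r : ℤ) + 1, 0 + (t : ℤ) + 1] : Site 2) = ![(M : ℤ), (t : ℤ) + 1] := by ext k; fin_cases k <;> [(simp; omega); simp]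
        rw [e1, e2, ← wallEdge_right_eq]
        exact hpass
  rw [base_add_smul_right] at run2
  -- Run 3: down `t` steps from `M c + (M, t)`
  have run3 : dualConfig ω ∈ openConnIn S ((M : ℤ) • c + ![0 + (M : ℤ), 0 + (t : ℤ)])
      ((M : ℤ) • c + ![0 + (M : ℤ), 0 + (t : ℤ)] + (t : ℤ) • stepVec (1, false)) := by
    refine openConnIn_dual_run hω _ (1, false) t (fun r hr => ?_) (fun r hr => ?_)
    · rw [base_add_smul_down]
      exact hS' (base_add_mem_cellFaces_right_iff.2 ⟨by omega, by omega, by omega, by omega⟩)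
    · rw [base_add_smul_down, crossedEdge_base_down]
      exact not_mem_of_clear hc' (Or.inr (base_add_mem_cellInterior_right_iff.2 ⟨by omega, by omega, by omega, by omega⟩))
  rw [base_add_smul_down] at run3
  -- assemble
  have h12 := PlanarDuality.openConnIn_trans run1 run2
  have h123 := PlanarDuality.openConnIn_trans h12 run3
  have estart : ((M : ℤ) • c + ![0, 0] : Site 2) = (M : ℤ) • c := base_add_zero M c
  have eend : ((M : ℤ) • c + ![0 + (M : ℤ), 0 + (t : ℤ) - (t : ℤ)] : Site 2) = (M : ℤ) • (c + Pi.single 0 1) := by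
    rw [base_right]; congr 1; ext k; fin_cases k <;> simp
  rw [estart, eend] at h123
  exact h123

/-- **Passage UPWARDS.** The same for the cells `c` and `c + e₁` (route: right `t`, up `M` through the missing wall
edge, left `t`). [folklore] -/
theorem openConnIn_dualConfig_passable_up {ω : BondConfig (Site 2)} (hω : ω ⊆ (zdGraph 2).edgeSet) {M : ℕ}
    (hM : 2 ≤ M) {c : Site 2}
    (hc : ∀ e ∈ ω, ∀ v ∈ e, v ∉ cellInterior M c)
    (hc' : ∀ e ∈ ω, ∀ v ∈ e, v ∉ cellInterior M (c + Pi.single 1 1))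
    {t : ℕ} (ht : t < M) (hpass : wallEdge M (c + Pi.single 1 1) 0 t ∉ ω)
    {S : Set (Site 2)} (hS : cellFaces M c ⊆ S) (hS' : cellFaces M (c + Pi.single 1 1) ⊆ S) :
    dualConfig ω ∈ openConnIn S ((M : ℤ) • c) ((M : ℤ) • (c + Pi.single 1 1)) := by
  -- Run 1: right `t` steps from `M c + (0,0)`
  have run1 : dualConfig ω ∈ openConnIn S ((M : ℤ) • c + ![0, 0]) ((M : ℤ) • c + ![0, 0] + (t : ℤ) • stepVec (0, true)) := by
    refine openConnIn_dual_run hω _ (0, true) t (fun r hr => ?_) (fun r hr => ?_)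
    · rw [base_add_smul_right]
      exact hS (base_add_mem_cellFaces_iff.2 ⟨by omega, by omega, le_rfl, by omega⟩)
    · rw [base_add_smul_right, crossedEdge_base_right]
      exact not_mem_of_clear hc (Or.inr (base_add_mem_cellInterior_iff.2 ⟨by omega, by omega, by omega, by omega⟩))
  rw [base_add_smul_right] at run1
  -- Run 2: up `M` steps from `M c + (t, 0)`
  have run2 : dualConfig ω ∈ openConnIn S ((M : ℤ) • c + ![0 + (t : ℤ), 0])
      ((M : ℤ) • c + ![0 + (t : ℤ), 0] + (M : ℤ) • stepVec (1, true)) := by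
    refine openConnIn_dual_run hω (S := S) ((M : ℤ) • c + ![0 + (t : ℤ), 0]) (1, true) M (fun r hr => ?_)
      (fun r hr => ?_)
    · rw [base_add_smul_up]
      rcases Nat.lt_or_ge r M with h | h
      · exact hS (base_add_mem_cellFaces_iff.2 ⟨by omega, by omega, by omega, by omega⟩)
      · exact hS' (base_add_mem_cellFaces_up_iff.2 ⟨by omega, by omega, by omega, by omega⟩)
    · rw [base_add_smul_up, crossedEdge_base_up]
      rcases Nat.lt_or_ge (r + 1) M with h | h
      · rcases Nat.eq_zero_or_pos t with h0 | h0
        · exact not_mem_of_clear hc (Or.inr (base_add_mem_cellInterior_iff.2 ⟨by omega, by omega, by omega, by omega⟩))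
        · exact not_mem_of_clear hc (Or.inl (base_add_mem_cellInterior_iff.2 ⟨by omega, by omega, by omega, by omega⟩))
      · have hrM : r + 1 = M := by omega
        have e1 : (![0 + (t : ℤ), 0 + (r : ℤ) + 1] : Site 2) = ![(t : ℤ), (M : ℤ)] := by ext k; fin_cases k <;> [simp; (simp; omega)]
        have e2 : (![0 + (t : ℤ) + 1, 0 + (r : ℤ) + 1] : Site 2) = ![(t : ℤ) + 1, (M : ℤ)] := by ext k; fin_cases k <;> [simp; (simp; omega)]
        rw [e1, e2, ← wallEdge_up_eq]
        exact hpass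
  rw [base_add_smul_up] at run2
  -- Run 3: left `t` steps from `M c + (t, M)`
  have run3 : dualConfig ω ∈ openConnIn S ((M : ℤ) • c + ![0 + (t : ℤ), 0 + (M : ℤ)])
      ((M : ℤ) • c + ![0 + (t : ℤ), 0 + (M : ℤ)] + (t : ℤ) • stepVec (0, false)) := by
    refine openConnIn_dual_run hω _ (0, false) t (fun r hr => ?_) (fun r hr => ?_)
    · rw [base_add_smul_left]
      exact hS' (base_add_mem_cellFaces_up_iff.2 ⟨by omega, by omega, by omega, by omega⟩)
    · rw [base_add_smul_left, crossedEdge_base_left]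
      exact not_mem_of_clear hc' (Or.inr (base_add_mem_cellInterior_up_iff.2 ⟨by omega, by omega, by omega, by omega⟩))
  rw [base_add_smul_left] at run3
  have h12 := PlanarDuality.openConnIn_trans run1 run2
  have h123 := PlanarDuality.openConnIn_trans h12 run3
  have estart : ((M : ℤ) • c + ![0, 0] : Site 2) = (M : ℤ) • c := base_add_zero M c
  have eend : ((M : ℤ) • c + ![0 + (t : ℤ) - (t : ℤ), 0 + (M : ℤ)] : Site 2) = (M : ℤ) • (c + Pi.single 1 1) := by
    rw [base_up]; congr 1; ext k; fin_cases k <;> simp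
  rw [estart, eend] at h123
  exact h123

/-! ## From coarse dual walks through clear cells to blocked dual paths -/

/-- The base plaquette `M c` belongs to the cell `c`. [folklore] -/
theorem base_mem_cellFaces {M : ℕ} (hM : 1 ≤ M) (c : Site 2) : (M : ℤ) • c ∈ cellFaces M c := by
  rw [← base_add_zero M c]
  exact base_add_mem_cellFaces_iff.2 ⟨le_rfl, by omega, le_rfl, by omega⟩

/-- The four directions. [folklore] -/
theorem dir_cases (dir : Fin 2 × Bool) :
    dir = (0, true) ∨ dir = (0, false) ∨ dir = (1, true) ∨ dir = (1, false) := by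
  obtain ⟨i, b⟩ := dir
  fin_cases i <;> cases b <;> simp

/-- **One coarse dual step.** If the cells `d`, `d'` are adjacent, both clear for `ω`, and the coarse dual edge
`{d, d'}` is open in `dualConfig (coarseConfig M ω)` (their common wall is passable), then `M d` and `M d'` are joined
by a `dualConfig ω`-open dual path inside any `S` containing the plaquettes of both cells. [folklore] -/
theorem openConnIn_dualConfig_of_coarse_adj {ω : BondConfig (Site 2)} (hω : ω ⊆ (zdGraph 2).edgeSet) {M : ℕ}
    (hM : 2 ≤ M) {d d' : Site 2}
    (hd : ∀ e ∈ ω, ∀ v ∈ e, v ∉ cellInterior M d) (hd' : ∀ e ∈ ω, ∀ v ∈ e, v ∉ cellInterior M d')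
    {S : Set (Site 2)} (hS : cellFaces M d ⊆ S) (hS' : cellFaces M d' ⊆ S)
    (hadj : s(d, d') ∈ dualConfig (coarseConfig M ω)) :
    dualConfig ω ∈ openConnIn S ((M : ℤ) • d) ((M : ℤ) • d') := by
  have hedge : s(d, d') ∈ (zdGraph 2).edgeSet := (mem_dualConfig_iff.1 hadj).1
  rw [SimpleGraph.mem_edgeSet, zdGraph_adj_iff_stepVec] at hedge
  obtain ⟨dir, rfl⟩ := hedge
  obtain ⟨t, ht, hpass⟩ := (coarse_dual_step_iff M ω d dir).1 hadj
  rcases dir_cases dir with rfl | rfl | rfl | rfl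
  · -- step RIGHT
    simp only [wallBase, show (0 : Fin 2).rev = 1 from by decide, if_true] at hpass
    have hst : stepVec ((0 : Fin 2), true) = Pi.single 0 1 := by simp [stepVec]
    rw [hst] at hS' hd' ⊢
    exact openConnIn_dualConfig_passable_right hω hM hd hd' ht hpass hS hS'
  · -- step LEFT: `d' = d - e₀`; the wall is that of `d` itself in direction `e₁`
    simp only [wallBase, show (0 : Fin 2).rev = 1 from by decide, Bool.false_eq_true, if_false] at hpass
    have hcell : d + stepVec ((0 : Fin 2), false) + Pi.single 0 1 = d := by
      simp [stepVec]
    have key := openConnIn_dualConfig_passable_right hω hM (c := d + stepVec ((0 : Fin 2), false))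
      (by exact hd') (by rw [hcell]; exact hd) ht (by rw [hcell]; exact hpass) (by exact hS') (by rw [hcell]; exact hS)
    rw [hcell] at key
    rw [openConnIn_comm]; exact key
  · -- step UP
    simp only [wallBase, show (1 : Fin 2).rev = 0 from by decide, if_true] at hpass
    have hst : stepVec ((1 : Fin 2), true) = Pi.single 1 1 := by simp [stepVec]
    rw [hst] at hS' hd' ⊢
    exact openConnIn_dualConfig_passable_up hω hM hd hd' ht hpass hS hS'
  · -- step DOWN: `d' = d - e₁`
    simp only [wallBase, show (1 : Fin 2).rev = 0 from by decide, Bool.false_eq_true, if_false] at hpass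
    have hcell : d + stepVec ((1 : Fin 2), false) + Pi.single 1 1 = d := by
      simp [stepVec]
    have key := openConnIn_dualConfig_passable_up hω hM (c := d + stepVec ((1 : Fin 2), false))
      (by exact hd') (by rw [hcell]; exact hd) ht (by rw [hcell]; exact hpass) (by exact hS')
      (by rw [hcell]; exact hS)
    rw [hcell] at key
    rw [openConnIn_comm]; exact key

/-- **Coarse dual walks through clear cells realise blocked dual paths** (GRIDWEDGE-PROOF §4.2 / §7 (M1)): if the
cells of `𝒞` are clear for `ω ⊆ E(ℤ²)` (`M ≥ 2`), `S` contains all their plaquettes, and `c`, `c'` are joined in `𝒞`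
by a path that is open in `dualConfig (coarseConfig M ω)` (a hole-chain through passable walls), then the plaquettes
`M c`, `M c'` are joined in `S` by a `dualConfig ω`-open dual path. [folklore] -/
theorem openConnIn_dualConfig_of_coarse {ω : BondConfig (Site 2)} (hω : ω ⊆ (zdGraph 2).edgeSet) {M : ℕ}
    (hM : 2 ≤ M) {𝒞 : Set (Site 2)} (hclear : ∀ d ∈ 𝒞, ∀ e ∈ ω, ∀ v ∈ e, v ∉ cellInterior M d)
    {S : Set (Site 2)} (hS : ∀ d ∈ 𝒞, cellFaces M d ⊆ S) {c c' : Site 2}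
    (h : dualConfig (coarseConfig M ω) ∈ openConnIn 𝒞 c c') :
    dualConfig ω ∈ openConnIn S ((M : ℤ) • c) ((M : ℤ) • c') := by
  obtain ⟨hc, hc', ⟨W⟩⟩ := h
  suffices key : ∀ (u v : 𝒞) (W' : ((openGraph (dualConfig (coarseConfig M ω))).induce 𝒞).Walk u v),
      dualConfig ω ∈ openConnIn S ((M : ℤ) • (u : Site 2)) ((M : ℤ) • (v : Site 2)) from key _ _ W
  intro u v W'
  induction W' with
  | nil => exact openConnIn_refl (hS _ (Subtype.coe_prop _) (base_mem_cellFaces (by omega) _))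
  | @cons x y z hxy _ ih =>
    refine PlanarDuality.openConnIn_trans ?_ ih
    have hxy' : (openGraph (dualConfig (coarseConfig M ω))).Adj (x : Site 2) (y : Site 2) :=
      SimpleGraph.induce_adj.1 hxy
    rw [openGraph_adj] at hxy'
    exact openConnIn_dualConfig_of_coarse_adj hω hM (hclear _ x.2) (hclear _ y.2) (hS _ x.2) (hS _ y.2) hxy'.1


end Summit.CriticalPhenomena.PercolationContinuityZ3.Theorems.TransplantSharpness
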